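import Mathlib

/-!
# Tool stub `stub_columnarSwirlSteadyEuler` of the line `Sketch`
# (crux `DyadicWallCascade.HalfSpaceHierarchy`, item stmt-AnomalousDissipation-18627)

Sorry-free discharge of the registered tool stub `stub_columnarSwirlSteadyEuler` of the lead's
skeleton `Cruxes/HalfSpaceHierarchy/Lines/Sketch.lean` (ideator-1 sketch `ColumnarSwirlSteadyEuler`,
card `slender-swirl-fission`): the columnar swirling vortex is an exact steady solution of the
incompressible Euler equations (the "leg" of the dyadic hierarchy of the crux).

**Statement.**  Let `σ w q : ℝ → ℝ` with `σ, w` smooth and `q' = σ² / 2` (`HasDerivAt q (σ ρ ^ 2 / 2) ρ`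
for every `ρ`).  On `ℝ³ = EuclideanSpace ℝ (Fin 3)` with coordinates `x = X 0`, `y = X 1`, `z = X 2`
put `ρ = x² + y²` and
`V X = σ ρ • (−y, x, 0) + w ρ • e₂`, `Q X = q ρ` (`e₂ = EuclideanSpace.single 2 1`).
Then `V` is divergence free, `Σᵢ (DV(X) eᵢ)ᵢ = 0`, and `(V, Q)` solves the steady Euler momentum
equation `DV(X)[V X] + ∇Q(X) = 0`, i.e. `(V·∇)V + ∇Q = 0` (centrifugal balance).

**Proof (pen and paper).**  Write `u = −σ y`, `v = σ x`, third component `w`, and `'` for `d/dρ`;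
`∂ₓρ = 2x`, `∂_yρ = 2y`.  Then
* `(V·∇)u = (−σy)(−2σ'xy) + (σx)(−σ − 2σ'y²) = −σ²x` and `∂ₓQ = 2x q' = σ²x`, sum `0`;
* `(V·∇)v = (−σy)(σ + 2σ'x²) + (σx)(2σ'xy) = −σ²y` and `∂_yQ = σ²y`, sum `0`;
* `(V·∇)w = (−σy)(2x w') + (σx)(2y w') = 0` and `∂_zQ = 0`;
* `div V = ∂ₓu + ∂_yv + ∂_zw = −2σ'xy + 2σ'xy + 0 = 0`.

**Lean proof.**  `ρ(Y) = Y 0 ^ 2 + Y 1 ^ 2` has derivative `h ↦ 2 (X 0) (h 0) + 2 (X 1) (h 1)`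
(`colSwirl_hasFDerivAt_rho`, from the coordinate projections `EuclideanSpace.proj`); the rotational
part `Y ↦ (−Y 1, Y 0, 0)` is a continuous linear map (`colSwirl_exists_rotCLM`), hence its own
derivative; `σ ∘ ρ`, `w ∘ ρ`, `q ∘ ρ` by the chain rule `HasDerivAt.comp_hasFDerivAt`; the field by
`HasFDerivAt.smul` / `.add` / `.smul_const`.  This gives the explicit directional derivative
`DV(X) h = σ ρ • (−h 1, h 0, 0) + (σ' ρ · Dρ h) • (−X 1, X 0, 0) + (w' ρ · Dρ h) • e₂`
(`colSwirl_fderiv_V_apply`) and `DQ(X) h = (σ ρ ^ 2 / 2) · Dρ h` (`colSwirl_fderiv_Q_apply`);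
the coordinates of the gradient are `(∇Q X)ᵢ = DQ(X) eᵢ` (Riesz, `colSwirl_gradient_coord`).  Both
clauses are then the polynomial identities above, closed coordinatewise by `simp` and `ring`.

Source: classical exact solution (columnar / swirling vortex with arbitrary radial profile, e.g. the
Rankine and Lamb–Oseen vortices): A. J. Majda, A. L. Bertozzi, *Vorticity and Incompressible Flow*,
CUP 2002, §2.2; P. G. Saffman, *Vortex Dynamics*, CUP 1992, §2.  Card
`slender-swirl-fission`.  Mathlib only; no named facts are used.  Deliberately NOT here: the
time-dependent (viscous, Lamb–Oseen) decay, and any statement about the vorticity of `V`.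
-/

set_option linter.dupNamespace false

noncomputable section

open scoped InnerProductSpace RealInnerProductSpace

namespace Summit.AnomalousDissipation.AnomalousDissipation.Theorems.HalfSpaceHierarchy

/-- Coordinates of a gradient on `ℝ³` are the directional derivatives along the standard basis,
`(∇f X)ᵢ = Df(X) eᵢ` with `eᵢ = EuclideanSpace.single i 1` (Riesz representation, Mathlib's
`InnerProductSpace.toDual_symm_apply`). [folklore] -/
private theorem colSwirl_gradient_coord (f : EuclideanSpace ℝ (Fin 3) → ℝ)
    (X : EuclideanSpace ℝ (Fin 3)) (i : Fin 3) :
    gradient f X i = fderiv ℝ f X (EuclideanSpace.single i 1) := by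
  have h1 : ⟪gradient f X, EuclideanSpace.single i (1 : ℝ)⟫ = gradient f X i := by
    simp only [EuclideanSpace.inner_single_right, one_mul, RCLike.conj_to_real]
  rw [← h1, gradient, InnerProductSpace.toDual_symm_apply]

/-- The coordinate function `Y ↦ Y i` of `ℝ³` is a continuous linear map (`EuclideanSpace.proj i`),
hence has derivative `EuclideanSpace.proj i` everywhere. [folklore] -/
private theorem colSwirl_hasFDerivAt_coord (i : Fin 3) (X : EuclideanSpace ℝ (Fin 3)) :
    HasFDerivAt (fun Y : EuclideanSpace ℝ (Fin 3) => Y i) (EuclideanSpace.proj (𝕜 := ℝ) i) X :=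
  (EuclideanSpace.proj (𝕜 := ℝ) i).hasFDerivAt

/-- The squared cylindrical radius `ρ(Y) = Y 0 ^ 2 + Y 1 ^ 2` is differentiable, with derivative
`Dρ(X) h = 2 (X 0) (h 0) + 2 (X 1) (h 1)` (product rule on the coordinates). [folklore] -/
private theorem colSwirl_hasFDerivAt_rho (X : EuclideanSpace ℝ (Fin 3)) :
    ∃ D : EuclideanSpace ℝ (Fin 3) →L[ℝ] ℝ,
      HasFDerivAt (fun Y : EuclideanSpace ℝ (Fin 3) => Y 0 ^ 2 + Y 1 ^ 2) D X ∧
        ∀ h : EuclideanSpace ℝ (Fin 3), D h = 2 * X 0 * h 0 + 2 * X 1 * h 1 := by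
  refine ⟨_, ((colSwirl_hasFDerivAt_coord 0 X).pow 2).fun_add
    ((colSwirl_hasFDerivAt_coord 1 X).pow 2), fun h => ?_⟩
  simp

/-- The rotational part `Y ↦ (−Y 1, Y 0, 0)` of the swirling vortex is a continuous linear map of
`ℝ³`. [folklore] -/
private theorem colSwirl_exists_rotCLM :
    ∃ L : EuclideanSpace ℝ (Fin 3) →L[ℝ] EuclideanSpace ℝ (Fin 3),
      ∀ Y : EuclideanSpace ℝ (Fin 3),
        L Y = (!₂[-(Y 1), Y 0, (0 : ℝ)] : EuclideanSpace ℝ (Fin 3)) :=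
  ⟨LinearMap.toContinuousLinearMap
      { toFun := fun Y => (!₂[-(Y 1), Y 0, (0 : ℝ)] : EuclideanSpace ℝ (Fin 3))
        map_add' := fun v w => by ext i; fin_cases i <;> (simp; try ring)
        map_smul' := fun c v => by ext i; fin_cases i <;> simp },
    fun _ => rfl⟩

/-- Directional derivatives of the columnar swirling vortex
`V(Y) = σ ρ • (−Y 1, Y 0, 0) + w ρ • e₂`, `ρ = Y 0 ^ 2 + Y 1 ^ 2`:
`DV(X) h = σ ρ • (−h 1, h 0, 0) + (σ' · Dρ h) • (−X 1, X 0, 0) + (w' · Dρ h) • e₂` with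
`Dρ h = 2 (X 0) (h 0) + 2 (X 1) (h 1)`, where `σ'`, `w'` are the derivatives of `σ`, `w` at `ρ(X)`
(chain and product rules). [folklore] -/
private theorem colSwirl_fderiv_V_apply {σ w : ℝ → ℝ} {σ' w' : ℝ} (X h : EuclideanSpace ℝ (Fin 3))
    (hσ : HasDerivAt σ σ' (X 0 ^ 2 + X 1 ^ 2)) (hw : HasDerivAt w w' (X 0 ^ 2 + X 1 ^ 2)) :
    fderiv ℝ (fun Y : EuclideanSpace ℝ (Fin 3) =>
        (σ (Y 0 ^ 2 + Y 1 ^ 2)) • (!₂[-(Y 1), Y 0, (0 : ℝ)] : EuclideanSpace ℝ (Fin 3)) +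
          (w (Y 0 ^ 2 + Y 1 ^ 2)) • EuclideanSpace.single (2 : Fin 3) (1 : ℝ)) X h =
      (σ (X 0 ^ 2 + X 1 ^ 2)) • (!₂[-(h 1), h 0, (0 : ℝ)] : EuclideanSpace ℝ (Fin 3)) +
        (σ' * (2 * X 0 * h 0 + 2 * X 1 * h 1)) •
          (!₂[-(X 1), X 0, (0 : ℝ)] : EuclideanSpace ℝ (Fin 3)) +
        (w' * (2 * X 0 * h 0 + 2 * X 1 * h 1)) • EuclideanSpace.single (2 : Fin 3) (1 : ℝ) := by
  obtain ⟨D, hD, hDh⟩ := colSwirl_hasFDerivAt_rho X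
  obtain ⟨L, hL⟩ := colSwirl_exists_rotCLM
  have hR : HasFDerivAt
      (fun Y : EuclideanSpace ℝ (Fin 3) => (!₂[-(Y 1), Y 0, (0 : ℝ)] : EuclideanSpace ℝ (Fin 3)))
      L X := by
    have hfun : (fun Y : EuclideanSpace ℝ (Fin 3) =>
        (!₂[-(Y 1), Y 0, (0 : ℝ)] : EuclideanSpace ℝ (Fin 3))) = ⇑L := (funext hL).symm
    rw [hfun]
    exact L.hasFDerivAt
  have hσρ : HasFDerivAt (fun Y : EuclideanSpace ℝ (Fin 3) => σ (Y 0 ^ 2 + Y 1 ^ 2)) (σ' • D) X :=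
    hσ.comp_hasFDerivAt X hD
  have hwρ : HasFDerivAt (fun Y : EuclideanSpace ℝ (Fin 3) => w (Y 0 ^ 2 + Y 1 ^ 2)) (w' • D) X :=
    hw.comp_hasFDerivAt X hD
  have hV : HasFDerivAt (fun Y : EuclideanSpace ℝ (Fin 3) =>
        (σ (Y 0 ^ 2 + Y 1 ^ 2)) • (!₂[-(Y 1), Y 0, (0 : ℝ)] : EuclideanSpace ℝ (Fin 3)) +
          (w (Y 0 ^ 2 + Y 1 ^ 2)) • EuclideanSpace.single (2 : Fin 3) (1 : ℝ))
      (σ (X 0 ^ 2 + X 1 ^ 2) • L +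
          (σ' • D).smulRight (!₂[-(X 1), X 0, (0 : ℝ)] : EuclideanSpace ℝ (Fin 3)) +
        (w' • D).smulRight (EuclideanSpace.single (2 : Fin 3) (1 : ℝ))) X :=
    (hσρ.smul hR).add (hwρ.smul_const (EuclideanSpace.single (2 : Fin 3) (1 : ℝ)))
  rw [hV.fderiv]
  simp only [add_apply, smul_apply, ContinuousLinearMap.smulRight_apply, hL, hDh, smul_eq_mul]

/-- Directional derivatives of the pressure `Q(Y) = q ρ`, `ρ = Y 0 ^ 2 + Y 1 ^ 2`:
`DQ(X) h = q'(ρ X) · (2 (X 0) (h 0) + 2 (X 1) (h 1))` (chain rule). [folklore] -/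
private theorem colSwirl_fderiv_Q_apply {q : ℝ → ℝ} {q' : ℝ} (X h : EuclideanSpace ℝ (Fin 3))
    (hq : HasDerivAt q q' (X 0 ^ 2 + X 1 ^ 2)) :
    fderiv ℝ (fun Y : EuclideanSpace ℝ (Fin 3) => q (Y 0 ^ 2 + Y 1 ^ 2)) X h =
      q' * (2 * X 0 * h 0 + 2 * X 1 * h 1) := by
  obtain ⟨D, hD, hDh⟩ := colSwirl_hasFDerivAt_rho X
  have hQ : HasFDerivAt (fun Y : EuclideanSpace ℝ (Fin 3) => q (Y 0 ^ 2 + Y 1 ^ 2)) (q' • D) X :=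
    hq.comp_hasFDerivAt X hD
  rw [hQ.fderiv, smul_apply, hDh, smul_eq_mul]

/-- **Tool stub `stub_columnarSwirlSteadyEuler` (the columnar swirling vortex is a steady Euler
flow).**  For smooth `σ, w : ℝ → ℝ` and `q` with `q' = σ² / 2`, the field
`V X = σ ρ • (−X 1, X 0, 0) + w ρ • e₂`, `ρ = (X 0)² + (X 1)²`, with pressure `Q X = q ρ`, is
divergence free, `Σᵢ (DV(X) eᵢ)ᵢ = 0`, and solves `DV(X)[V X] + ∇Q(X) = 0` on all of `ℝ³`
(centrifugal balance; Majda–Bertozzi, *Vorticity and Incompressible Flow*, §2.2; Saffman,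
*Vortex Dynamics*, §2).  Proof: explicit directional derivatives and a coordinatewise polynomial
identity, see the module docstring. [folklore] -/
theorem stub_columnarSwirlSteadyEuler :
    ∀ (σ w q : ℝ → ℝ) (V : EuclideanSpace ℝ (Fin 3) → EuclideanSpace ℝ (Fin 3)) (Q : EuclideanSpace ℝ (Fin 3) → ℝ),
      ContDiff ℝ ((⊤ : ℕ∞) : WithTop ℕ∞) σ → ContDiff ℝ ((⊤ : ℕ∞) : WithTop ℕ∞) w →
      (∀ ρ : ℝ, HasDerivAt q (σ ρ ^ 2 / 2) ρ) →
      (∀ X : EuclideanSpace ℝ (Fin 3), V X = (σ (X 0 ^ 2 + X 1 ^ 2)) • (!₂[-(X 1), X 0, (0 : ℝ)] : EuclideanSpace ℝ (Fin 3))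
          + (w (X 0 ^ 2 + X 1 ^ 2)) • EuclideanSpace.single (2 : Fin 3) (1 : ℝ)) →
      (∀ X : EuclideanSpace ℝ (Fin 3), Q X = q (X 0 ^ 2 + X 1 ^ 2)) →
      (∀ X : EuclideanSpace ℝ (Fin 3), ∑ i : Fin 3, (fderiv ℝ V X (EuclideanSpace.single i (1 : ℝ))) i = 0) ∧
      (∀ X : EuclideanSpace ℝ (Fin 3), (fderiv ℝ V X) (V X) + gradient Q X = 0) := by
  intro σ w q V Q hσ hw hq hV hQ
  have hVfun : V = fun X : EuclideanSpace ℝ (Fin 3) =>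
      (σ (X 0 ^ 2 + X 1 ^ 2)) • (!₂[-(X 1), X 0, (0 : ℝ)] : EuclideanSpace ℝ (Fin 3)) +
        (w (X 0 ^ 2 + X 1 ^ 2)) • EuclideanSpace.single (2 : Fin 3) (1 : ℝ) :=
    funext hV
  have hQfun : Q = fun X : EuclideanSpace ℝ (Fin 3) => q (X 0 ^ 2 + X 1 ^ 2) := funext hQ
  have hσd : ∀ t : ℝ, HasDerivAt σ (deriv σ t) t := fun t =>
    (hσ.differentiable (by simp) t).hasDerivAt
  have hwd : ∀ t : ℝ, HasDerivAt w (deriv w t) t := fun t =>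
    (hw.differentiable (by simp) t).hasDerivAt
  -- explicit directional derivatives of `V` and coordinates of `∇Q`
  have hDV : ∀ X h : EuclideanSpace ℝ (Fin 3), fderiv ℝ V X h =
      (σ (X 0 ^ 2 + X 1 ^ 2)) • (!₂[-(h 1), h 0, (0 : ℝ)] : EuclideanSpace ℝ (Fin 3)) +
        (deriv σ (X 0 ^ 2 + X 1 ^ 2) * (2 * X 0 * h 0 + 2 * X 1 * h 1)) •
          (!₂[-(X 1), X 0, (0 : ℝ)] : EuclideanSpace ℝ (Fin 3)) +
        (deriv w (X 0 ^ 2 + X 1 ^ 2) * (2 * X 0 * h 0 + 2 * X 1 * h 1)) •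
          EuclideanSpace.single (2 : Fin 3) (1 : ℝ) := by
    intro X h
    rw [hVfun]
    exact colSwirl_fderiv_V_apply X h (hσd _) (hwd _)
  have hGQ : ∀ (X : EuclideanSpace ℝ (Fin 3)) (i : Fin 3), gradient Q X i =
      σ (X 0 ^ 2 + X 1 ^ 2) ^ 2 / 2 *
        (2 * X 0 * (EuclideanSpace.single i (1 : ℝ) : EuclideanSpace ℝ (Fin 3)) 0 +
          2 * X 1 * (EuclideanSpace.single i (1 : ℝ) : EuclideanSpace ℝ (Fin 3)) 1) := by
    intro X i
    rw [colSwirl_gradient_coord, hQfun, colSwirl_fderiv_Q_apply X _ (hq _)]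
  refine ⟨fun X => ?_, fun X => ?_⟩
  · -- divergence: `-2σ'xy + 2σ'xy + 0 = 0`
    simp only [Fin.sum_univ_three, hDV]
    simp
    ring
  · -- momentum: the radial derivative `Dρ (V X)` vanishes, then centrifugal balance
    have hrad : 2 * X 0 * V X 0 + 2 * X 1 * V X 1 = 0 := by
      rw [hV X]
      simp
      ring
    ext i
    rw [PiLp.add_apply, hDV, hrad, hGQ, hV X, PiLp.zero_apply]
    fin_cases i
    · simp
      ring
    · simp
      ring
    · simp

end Summit.AnomalousDissipation.AnomalousDissipation.Theorems.HalfSpaceHierarchy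

end
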